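import Mathlib
import Summits.AnomalousDissipation.AnomalousDissipation.Theses.MarginalStabilityChain

/-!
# Crux idea `layer-generation-relay` — first lemmas (ideator 1, round 1, crux stmt-AnomalousDissipation-14249)

Crux: `ChainRealisation := StrainedLayerLaw → BurgersLayerKH → StretchedVortexRows → ChainThesis`.

Contents
* §0 `chainRealisation_of_chainThesis` — the typed antecedents are logically inert (kernel-checked triviality;
  = the refuter's W.lean probe): every proof of the crux factors through `ChainThesis`.
* §1 `drain_ceiling` — PROVED: a flux floor `Π ≥ κ·E^{3/2}` in the large-scale energy budget
  `E' ≤ F·√E − κ·E·√E` fences the energy by `max(E(0), F/κ)` (the ν-uniform energy ceiling of the card's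
  ArenaFeed step is an ODE comparison once the relay drains the large scales).
* §2 `silence_gronwall` — PROVED: `Z' ≤ Z ⇒ Z(t) ≤ Z(0)·e^t` (abstract form of the FINITE-WINDOW SILENCE of the
  stretched-2-D unit cell: total enstrophy grows at most at the strain rate, so the window-mean dissipation of
  `StrainedLayerLaw`'s class over `[0,T]` is `≤ (e^T/T)·(√(ν/4π) + O(ν^{3/4}))`).
* §3 `StretchedEnstrophyLaw` — STATED (Prop): the enstrophy identity `Z' = Z − 2νP` for classical solutions of
  the stretched two-dimensional Navier–Stokes system of `StrainedLayerLaw` (γ = ΔU = 1) with Gaussian-class decay.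
* §4 `ForwardRegularLoudFamilyFor`, `EternalisationAt` (re-declared from the 3005 line generic-point-eternalisation,
  same statements) and the PROVED composition `chainRealisation_of_forwardFamily`: the relay's T³ output
  (a forward-regular loud bounded family for ONE force) + eternalisation at each viscosity ⇒ the crux BY NAME.
-/

noncomputable section

set_option linter.dupNamespace false

namespace Summit.AnomalousDissipation.AnomalousDissipation.Cruxes.ChainRealisation.LayerGenerationRelay

open MeasureTheory Filter Set
open Literature.Analysis.FunctionSpaces Literature.Analysis.FluidPDE
open Summit.AnomalousDissipation.AnomalousDissipation.Theses.MarginalStabilityChain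

local notation "𝕋³" => UnitAddTorus (Fin 3)
local notation "E³" => EuclideanSpace ℝ (Fin 3)

/-! ## §0 The antecedents are inert -/

/-- Every proof of `ChainThesis` is a proof of `ChainRealisation` (the three unit-cell hypotheses are
discarded).  Conversely a proof of `ChainRealisation` that USES `h2 h3 h4` would need a transfer theorem from the
stretched-2-D class on `ℝ²` / the ODE on `ℝ` to `T³`; §2–§3 and the card's log-budget show that no such transfer
can carry ν-independent information at the primary scale. [folklore] -/
theorem chainRealisation_of_chainThesis (h : ChainThesis) : ChainRealisation := fun _ _ _ => h

/-! ## §1 Drain ⇒ ceiling -/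

/-- **Drain ⇒ ceiling (proved).**  If a nonnegative continuous `e` (large-scale energy along one trajectory) has a
right derivative satisfying `e' ≤ F·√e − κ·e·√e` on `[0,T)` (injection `≤ ‖f‖₂√e`, flux to the relay
`≥ κ e^{3/2}`, `κ = c/ℓ`), then `e ≤ max (e 0) (F/κ)` on `[0,T]`: the ν-uniform energy ceiling with
`E = max(E₀, ‖f‖₂ ℓ / c)`. -/
theorem drain_ceiling {e e' : ℝ → ℝ} {F κ T : ℝ} (hκ : 0 < κ) (hF : 0 ≤ F)
    (hcont : ContinuousOn e (Icc 0 T))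
    (hderiv : ∀ t ∈ Ico 0 T, HasDerivWithinAt e (e' t) (Ici t) t)
    (hineq : ∀ t ∈ Ico 0 T, e' t ≤ F * Real.sqrt (e t) - κ * e t * Real.sqrt (e t)) :
    ∀ t ∈ Icc 0 T, e t ≤ max (e 0) (F / κ) := by
  intro t ht
  set K := max (e 0) (F / κ) with hK
  -- fence by every constant K' > K, then let K' ↓ K
  have fence : ∀ K' : ℝ, K < K' → e t ≤ K' := by
    intro K' hK'
    have hK'pos : 0 < K' := lt_of_le_of_lt (le_trans (div_nonneg hF hκ.le) (le_max_right _ _)) hK'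
    have hFK' : F - κ * K' < 0 := by
      have : F / κ < K' := lt_of_le_of_lt (le_max_right _ _) hK'
      have h2 : F < κ * K' := by rwa [div_lt_iff₀ hκ, mul_comm] at this
      linarith
    refine image_le_of_deriv_right_lt_deriv_boundary (f := e) (f' := e') (a := 0) (b := T)
      hcont hderiv (B := fun _ => K') (B' := fun _ => 0) ?_ (fun x => hasDerivAt_const x K') ?_ ht
    · exact le_of_lt (lt_of_le_of_lt (le_max_left _ _) hK')
    · intro x hx hex
      have h1 := hineq x hx
      rw [hex] at h1
      have hs : 0 < Real.sqrt K' := Real.sqrt_pos.mpr hK'pos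
      have : F * Real.sqrt K' - κ * K' * Real.sqrt K' = (F - κ * K') * Real.sqrt K' := by ring
      rw [this] at h1
      exact lt_of_le_of_lt h1 (mul_neg_of_neg_of_pos hFK' hs)
  by_contra hcon
  push Not at hcon
  have := fence ((K + e t) / 2) (by linarith)
  linarith

/-! ## §2 Finite-window silence (abstract Grönwall form) -/

/-- **Silence (proved, abstract form).**  If `Z` (total enstrophy of the stretched-2-D unit cell) is continuous on
`[0,T]` with right derivative `Z' ≤ Z` (stretching at the unit strain rate; the viscous term only helps), then
`Z t ≤ Z 0 · e^t`.  With `Z 0 = L/(2√(πν)) + O(ν^{-1/4})` for the datum `U_B + θ` and `D = (ν/L)·Z` this is the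
finite-window silence `D(t) ≤ e^t (√(ν/4π) + O(ν^{3/4}))` of the card. -/
theorem silence_gronwall {Z Z' : ℝ → ℝ} {T : ℝ} (hcont : ContinuousOn Z (Icc 0 T))
    (hderiv : ∀ t ∈ Ico 0 T, HasDerivWithinAt Z (Z' t) (Ici t) t)
    (hineq : ∀ t ∈ Ico 0 T, Z' t ≤ Z t) :
    ∀ t ∈ Icc 0 T, Z t ≤ Z 0 * Real.exp t := by
  intro t ht
  have h := le_gronwallBound_of_liminf_deriv_right_le (f := Z) (f' := Z') (δ := Z 0) (K := 1) (ε := 0)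
    (a := 0) (b := T) hcont (fun x hx _ hr => (hderiv x hx).liminf_right_slope_le hr) le_rfl
    (fun x hx => by simpa using hineq x hx) t ht
  simpa [gronwallBound_ε0] using h

/-! ## §3 The enstrophy law of the stretched two-dimensional class (stated) -/

/-- **Stretched enstrophy law (stated; size S–M, folklore).**  For classical solutions `(u,v,p)` of the stretched
two-dimensional Navier–Stokes system of `StrainedLayerLaw` (exact columnar reduction `V = (u, v − y, z)` of 3-D
NS; strain and jump normalised to 1), `L`-periodic in `x`, whose vorticity `ω = vₓ − u_y` and its gradient have
Gaussian-class decay in `y`, the vorticity obeys `ωₜ + uωₓ + (v − y)ω_y = ω + νΔω`, hence the period enstrophy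
`Z(t) = ∫₀ᴸ∫_ℝ ω²` satisfies `Z' = Z − 2νP`, `P = ∫₀ᴸ∫_ℝ |∇ω|²` (transport by `(u, v − y)`, whose divergence is
`−1`, contributes `−Z/2` to `d/dt(Z/2)`; stretching contributes `+Z`; viscosity `−νP`: net `Z' = Z − 2νP`).  Together with
`∫∫|∇(u,v)|² = Z` (div-free, null-Lagrangian boundary term) and `silence_gronwall` it gives the finite-window
silence of the unit cell. -/
def StretchedEnstrophyLaw : Prop :=
  ∀ (ν L : ℝ), 0 < ν → 0 < L → ∀ (u v p : ℝ → ℝ → ℝ → ℝ),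
    let Dt : (ℝ → ℝ → ℝ → ℝ) → ℝ → ℝ → ℝ → ℝ := fun f t x y => deriv (fun s => f s x y) t
    let Dx : (ℝ → ℝ → ℝ → ℝ) → ℝ → ℝ → ℝ → ℝ := fun f t x y => deriv (fun s => f t s y) x
    let Dy : (ℝ → ℝ → ℝ → ℝ) → ℝ → ℝ → ℝ → ℝ := fun f t x y => deriv (fun s => f t x s) y
    let ω : ℝ → ℝ → ℝ → ℝ := fun t x y => Dx v t x y - Dy u t x y
    let Z : ℝ → ℝ := fun t => ∫ x in Set.Ioc 0 L, ∫ y, (ω t x y) ^ 2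
    let P : ℝ → ℝ := fun t => ∫ x in Set.Ioc 0 L, ∫ y, ((Dx ω t x y) ^ 2 + (Dy ω t x y) ^ 2)
    (ContDiffOn ℝ 3 (fun q : ℝ × ℝ × ℝ => u q.1 q.2.1 q.2.2) (Set.Ioi 0 ×ˢ Set.univ) ∧
     ContDiffOn ℝ 3 (fun q : ℝ × ℝ × ℝ => v q.1 q.2.1 q.2.2) (Set.Ioi 0 ×ˢ Set.univ) ∧
     ContDiffOn ℝ 2 (fun q : ℝ × ℝ × ℝ => p q.1 q.2.1 q.2.2) (Set.Ioi 0 ×ˢ Set.univ) ∧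
     (∀ t x y, 0 < t →
        Dt u t x y + u t x y * Dx u t x y + (v t x y - y) * Dy u t x y =
            -Dx p t x y + ν * (Dx (Dx u) t x y + Dy (Dy u) t x y) ∧
        Dt v t x y + u t x y * Dx v t x y + (v t x y - y) * Dy v t x y - v t x y =
            -Dy p t x y + ν * (Dx (Dx v) t x y + Dy (Dy v) t x y) ∧
        Dx u t x y + Dy v t x y = 0) ∧
     (∀ t x y, 0 < t → u t (x + L) y = u t x y ∧ v t (x + L) y = v t x y ∧ p t (x + L) y = p t x y) ∧
     (∀ t, 0 < t → ∃ C : ℝ, 0 < C ∧ ∀ x y,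
        |ω t x y| + |Dx ω t x y| + |Dy ω t x y| + |Dx (Dx ω) t x y| + |Dy (Dy ω) t x y| + |Dt ω t x y|
          ≤ C * Real.exp (-(y ^ 2) / C)) ∧
     (∀ t x, 0 < t → Tendsto (fun y => u t x y) atTop (nhds (1 / 2)) ∧
        Tendsto (fun y => u t x y) atBot (nhds (-(1 / 2))) ∧
        Tendsto (fun y => v t x y) atTop (nhds 0) ∧ Tendsto (fun y => v t x y) atBot (nhds 0))) →
    ∀ t, 0 < t → HasDerivAt Z (Z t - 2 * ν * P t) t

/-! ## §4 The T³ side: relay output + eternalisation ⇒ the crux by name -/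

/-- **Relay output for ONE force** (= the 3005 line's C⁺ `ForwardRegularLoudFamily`, with the force fixed in
advance): `ν_j → 0`, classical solutions on `[0,∞) × T³` from smooth data, enstrophy bounded on `t ≥ 1`
(a `j`-dependent bound), limsup-mean energy `≤ E`, limsup-mean dissipation `≥ ε`.  This is what the card's
ArenaFeed ∧ GenerationRelay are to deliver for the arena force. -/
def ForwardRegularLoudFamilyFor (f : 𝕋³ → E³) : Prop :=
  ∃ (ν : ℕ → ℝ) (u : ℕ → ℝ → 𝕋³ → E³) (p : ℕ → ℝ → 𝕋³ → ℝ),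
    (∀ j, 0 < ν j) ∧ Tendsto ν atTop (nhds 0) ∧
    (∀ j, Torus.IsClassicalNSSolutionOn (Set.Ici 0) (ν j) (fun _ => f) (u j) (p j)) ∧
    (∀ j, ∃ M : ℝ, ∀ t : ℝ, 1 ≤ t → Torus.gradNormSq (u j t) ≤ M) ∧
    (∃ E : ℝ, ∀ j, meanEnergy (u j) ≤ E) ∧
    ∃ ε : ℝ, 0 < ε ∧ ∀ j, ε ≤ meanDissipation (ν j) (u j)

/-- **Eternalisation at one viscosity** (statement of the 3005 line `generic-point-eternalisation` /
`cesaro-serrin-moment-eternal`, passed triage r1; re-declared verbatim). -/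
def EternalisationAt (ν : ℝ) (f : 𝕋³ → E³) : Prop :=
  ∀ (u : ℝ → 𝕋³ → E³) (p : ℝ → 𝕋³ → ℝ) (E ε : ℝ),
    Torus.IsClassicalNSSolutionOn (Set.Ici 0) ν (fun _ => f) u p →
    (∃ M : ℝ, ∀ t : ℝ, 1 ≤ t → Torus.gradNormSq (u t) ≤ M) →
    meanEnergy u ≤ E → 0 < ε → ε ≤ meanDissipation ν u →
    ∃ (v : ℝ → 𝕋³ → E³) (q : ℝ → 𝕋³ → ℝ),
      Torus.IsClassicalNSSolutionOn Set.univ ν (fun _ => f) v q ∧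
      meanEnergy v ≤ 16 * (∫ x, ‖f x‖ ^ 2) * (max E 1) ^ 2 / ε ^ 2 ∧
      ε / 2 ≤ meanDissipation ν v

/-- **Composition (kernel-checked).**  A forward-regular loud bounded family for ONE smooth solenoidal mean-zero
force (the relay's output) and eternalisation at each of its viscosities give the crux `ChainRealisation` BY NAME
(through `ChainThesis`; the unit-cell antecedents are not consumed — §0). -/
theorem chainRealisation_of_forwardFamily {f : 𝕋³ → E³}
    (hf : Torus.IsSmooth f) (hdiv : Torus.IsDivFree f) (hmean : Torus.HasZeroMean f)
    (hEt : ∀ ν : ℝ, 0 < ν → EternalisationAt ν f)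
    (hC : ForwardRegularLoudFamilyFor f) :
    ChainRealisation := by
  refine chainRealisation_of_chainThesis ?_
  obtain ⟨ν, u, p, hν, hν0, hsol, hM, ⟨E, hE⟩, ε, hε, hεle⟩ := hC
  have key : ∀ j, ∃ (v : ℝ → 𝕋³ → E³) (q : ℝ → 𝕋³ → ℝ),
      Torus.IsClassicalNSSolutionOn Set.univ (ν j) (fun _ => f) v q ∧
      meanEnergy v ≤ 16 * (∫ x, ‖f x‖ ^ 2) * (max E 1) ^ 2 / ε ^ 2 ∧
      ε / 2 ≤ meanDissipation (ν j) v :=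
    fun j => hEt (ν j) (hν j) (u j) (p j) E ε (hsol j) (hM j) (hE j) hε (hεle j)
  choose v q hv using key
  exact ⟨f, hf, hdiv, hmean, ν, v, q, hν, hν0, fun j => (hv j).1, ⟨_, fun j => (hv j).2.1⟩, ε / 2,
    by positivity, fun j => (hv j).2.2⟩

end Summit.AnomalousDissipation.AnomalousDissipation.Cruxes.ChainRealisation.LayerGenerationRelay

end
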